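import Summits.CriticalPhenomena.PercolationContinuityZ3.Theorems.PercNearOneGluingNoHeavyLowerTailSahiSunflowerOnePayer
import Mathlib.Tactic.Linarith
import Mathlib.Tactic.Ring
import Mathlib.Tactic.FinCases
import HarnessLib

/-!
# `NoHeavyLowerTail` (crux stmt-CriticalPhenomena-4575), master-family line P1 (gen 22):
# second-order Harris for sunflowers, II — **level `k = 3` of `SunflowerOnePayer` is EXACTLY the one-payer conjecture S₃^max**

Support file (seat `prim-masterthm-p1`, gen 22; `--supports stmt-CriticalPhenomena-4575`).  No definition, no `sorry`, standard axioms.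
Companion of `…SahiSunflowerOnePayer` (the typed `k`-petal conjecture `SunflowerOnePayer k p`, its `k = 2` case and its
monotonicity in `k`).  Memo `run/shared/lean/prim/prim-masterthm/FROM-prim-masterthm-p1-g22-SUNFLOWER-ONE-PAYER.md`.

THE DICTIONARY.  A sandwiched increasing triple `(A, B, N)` of `…SahiStrongCubicMax` (cells `α, β, d`, core `κ`, outside `o`,
`G = κo − e₂`) carries the 3-sunflower `(A∩N, B∩N, A∩B)` with kernel `A∩B∩N` (`IsSunflower`), whose outside is `(A∪B)ᶜ` and
whose complementary down-sets (`petalDown`) are `Bᶜ, Aᶜ, Nᶜ`; the member masses are `α+κ, β+κ, d+κ` and the down-set masses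
`1−(β+κ+d), 1−(α+κ+d), 1−(α+β+κ)`, so that `κ² − Π μ(U_i) = κ·G − e₃` and `o² − Π μ(D_i) = o·G − e₃` (pure algebra on the five
cells).  Conversely a 3-sunflower `(U_0, U_1, U_2)` with kernel `K` is the sunflower of the sandwiched triple
`(U_0 ∪ U_2, U_1 ∪ U_2, U_0 ∪ U_1)` (petals `U_i ∖ K`).  Hence:
* `strongCubicMaxNonneg_of_sunflowerOnePayer_three`, `sunflowerOnePayer_three_of_strongCubicMaxNonneg`,
  **`sunflowerOnePayer_three_iff : SunflowerOnePayer 3 p ↔ StrongCubicMaxNonneg p`** ("the heavier of kernel and outside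
  pays" is `outside_sub_core_slack`: the two one-sided slacks differ by `(o − κ)·G`);
* `strongCubicMaxNonneg_of_sunflowerOnePayer`: every level `k ≥ 3` of the conjecture implies S₃^max (by monotonicity in `k`),
  hence S₃⁺, S₃ and the co-sunflower class law (links of `…SahiStrongCubicMax`).
HONEST FRAMING: equivalences and reductions only; S₃^max and `SunflowerOnePayer k` for `k ≥ 3` remain OPEN. [this work]
-/

noncomputable section

open scoped Classical

namespace Summit.CriticalPhenomena.PercolationContinuityZ3.Theorems

namespace SahiDeepCore

open Literature.Combinatorics.Sahi2008
open Literature.Probability.Percolation (DeterminedBy)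
open Literature.Probability.Percolation.DecisionTree (ind ind_of_mem ind_of_not_mem ind_nonneg)

variable {ι : Type} [Fintype ι]

local notation3 (prettyPrint := false) "m⟦" p ", " X "⟧" => ex (bernoulliWeight p) (ind X)

/-! ### 0'. Mass bookkeeping (private) -/

omit [Fintype ι] in
/-- Cell masses are nonnegative. [folklore] -/
private theorem massT_nonneg [Fintype ι] (p : ι → unitInterval) (X : Set (Set ι)) : 0 ≤ m⟦p, X⟧ :=
  ex_nonneg (isFKGMeasure_bernoulliWeight p).nonneg fun ω => ind_nonneg _ ω

omit [Fintype ι] in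
/-- `1_X = 1_{X ∩ Y} + 1_{X ∖ Y}`. [folklore] -/
private theorem indT_split (X Y : Set (Set ι)) : ind X = ind (X ∩ Y) + ind (X \ Y) := by
  funext ω
  simp only [Pi.add_apply]
  by_cases hX : ω ∈ X
  · by_cases hY : ω ∈ Y
    · rw [ind_of_mem hX, ind_of_mem (show ω ∈ X ∩ Y from ⟨hX, hY⟩), ind_of_not_mem (show ω ∉ X \ Y from fun h => h.2 hY)]
      norm_num
    · rw [ind_of_mem hX, ind_of_not_mem (show ω ∉ X ∩ Y from fun h => hY h.2), ind_of_mem (show ω ∈ X \ Y from ⟨hX, hY⟩)]; norm_num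
  · rw [ind_of_not_mem hX, ind_of_not_mem (show ω ∉ X ∩ Y from fun h => hX h.1),
      ind_of_not_mem (show ω ∉ X \ Y from fun h => hX h.1)]
    norm_num

/-- `μ(X) = μ(X ∩ Y) + μ(X ∖ Y)`. [folklore] -/
private theorem massT_split (p : ι → unitInterval) (X Y : Set (Set ι)) : m⟦p, X⟧ = m⟦p, X ∩ Y⟧ + m⟦p, X \ Y⟧ := by
  have h := congrArg (ex (bernoulliWeight p)) (indT_split X Y)
  rwa [ex_add] at h

omit [Fintype ι] in
/-- `1_{Xᶜ} + 1_X = 1`. [folklore] -/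
private theorem indT_compl_add (X : Set (Set ι)) : ind Xᶜ + ind X = fun _ => (1 : ℝ) := by
  funext ω
  simp only [Pi.add_apply]
  by_cases h : ω ∈ X
  · rw [ind_of_mem h, ind_of_not_mem (show ω ∉ Xᶜ from fun h' => h' h)]; norm_num
  · rw [ind_of_not_mem h, ind_of_mem (show ω ∈ Xᶜ from h)]; norm_num

/-- `μ(Xᶜ) = 1 − μ(X)`. [folklore] -/
private theorem massT_compl (p : ι → unitInterval) (X : Set (Set ι)) : m⟦p, Xᶜ⟧ = 1 - m⟦p, X⟧ := by
  have h := congrArg (ex (bernoulliWeight p)) (indT_compl_add X)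
  rw [ex_add, ex_const (sum_bernoulliWeight p)] at h
  linarith

omit [Fintype ι] in
/-- `∀` over `Fin 3`, unrolled. [folklore] -/
private theorem forallT_fin_three {P : Fin 3 → Prop} : (∀ i, P i) ↔ P 0 ∧ P 1 ∧ P 2 := by
  refine ⟨fun h => ⟨h 0, h 1, h 2⟩, fun ⟨h0, h1, h2⟩ i => ?_⟩
  fin_cases i <;> assumption

/-! ### 1'. `SunflowerOnePayer 3 ⟹ S₃^max` -/

/-- **`SunflowerOnePayer 3 ⟹ S₃^max`**: a sandwiched increasing triple `(A, B, N)` carries the 3-sunflower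
`(A∩N, B∩N, A∩B)` with kernel `A∩B∩N`, outside `(A∪B)ᶜ` and complementary down-sets `Bᶜ, Aᶜ, Nᶜ`, whose masses in the
five cells are `α+κ, β+κ, d+κ`, resp. `o+α, o+β, o+d`; the one-payer statement for it is `e₃ ≤ max(κ,o)·G`. [this work] -/
theorem strongCubicMaxNonneg_of_sunflowerOnePayer_three (p : ι → unitInterval) (h : SunflowerOnePayer 3 p) :
    StrongCubicMaxNonneg p := by
  intro S A B N hA hB hN hAB hBA hNs _ _ _
  -- the vector and its components
  have e0 : ![A ∩ N, B ∩ N, A ∩ B] 0 = A ∩ N := rfl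
  have e1 : ![A ∩ N, B ∩ N, A ∩ B] 1 = B ∩ N := rfl
  have e2 : ![A ∩ N, B ∩ N, A ∩ B] 2 = A ∩ B := rfl
  -- sunflower structure
  have hK01 : (A ∩ N) ∩ (B ∩ N) = A ∩ B ∩ N := by ext ω; simp only [Set.mem_inter_iff]; tauto
  have hK02 : (A ∩ N) ∩ (A ∩ B) = A ∩ B ∩ N := by ext ω; simp only [Set.mem_inter_iff]; tauto
  have hK12 : (B ∩ N) ∩ (A ∩ B) = A ∩ B ∩ N := by ext ω; simp only [Set.mem_inter_iff]; tauto
  have hsf : IsSunflower ![A ∩ N, B ∩ N, A ∩ B] (A ∩ B ∩ N) := by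
    intro i j hij
    fin_cases i <;> fin_cases j
    · exact absurd rfl hij
    · exact hK01
    · exact hK02
    · simp only [Fin.mk_one, Fin.isValue, Fin.zero_eta]; rw [e1, e0, Set.inter_comm]; exact hK01
    · exact absurd rfl hij
    · exact hK12
    · simp only [Fin.reduceFinMk, Fin.isValue, Fin.zero_eta]; rw [e2, e0, Set.inter_comm]; exact hK02
    · simp only [Fin.reduceFinMk, Fin.isValue, Fin.mk_one]; rw [e2, e1, Set.inter_comm]; exact hK12
    · exact absurd rfl hij
  have hup : ∀ i, IsUpperSet (![A ∩ N, B ∩ N, A ∩ B] i) := by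
    rw [forallT_fin_three, e0, e1, e2]
    exact ⟨hA.inter hN, hB.inter hN, hA.inter hB⟩
  -- outside and complementary down-sets
  have hO : outside ![A ∩ N, B ∩ N, A ∩ B] = (A ∪ B)ᶜ := by
    ext ω
    simp only [outside, Set.mem_setOf_eq, forallT_fin_three, e0, e1, e2, Set.mem_inter_iff, Set.mem_compl_iff,
      Set.mem_union, not_and, not_or]
    constructor
    · rintro ⟨h1, h2, h3⟩
      refine ⟨fun ha => ?_, fun hb => ?_⟩
      · by_cases hb : ω ∈ B
        · exact h3 ha hb
        · exact h1 ha (hAB ⟨ha, hb⟩)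
      · by_cases ha : ω ∈ A
        · exact h3 ha hb
        · exact h2 hb (hBA ⟨hb, ha⟩)
    · rintro ⟨ha, hb⟩
      exact ⟨fun h _ => ha h, fun h _ => hb h, fun h _ => ha h⟩
  have hD0 : petalDown ![A ∩ N, B ∩ N, A ∩ B] 0 = Bᶜ := by
    ext ω
    simp only [petalDown, Set.mem_setOf_eq, forallT_fin_three, e0, e1, e2, Set.mem_inter_iff, Set.mem_compl_iff, not_and]
    constructor
    · rintro ⟨-, h2, h3⟩ hb
      by_cases ha : ω ∈ A
      · exact h3 (by decide) ha hb
      · exact h2 (by decide) hb (hBA ⟨hb, ha⟩)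
    · intro hb
      exact ⟨fun h => absurd rfl h, fun _ h _ => hb h, fun _ _ h => hb h⟩
  have hD1 : petalDown ![A ∩ N, B ∩ N, A ∩ B] 1 = Aᶜ := by
    ext ω
    simp only [petalDown, Set.mem_setOf_eq, forallT_fin_three, e0, e1, e2, Set.mem_inter_iff, Set.mem_compl_iff, not_and]
    constructor
    · rintro ⟨h1, -, h3⟩ ha
      by_cases hb : ω ∈ B
      · exact h3 (by decide) ha hb
      · exact h1 (by decide) ha (hAB ⟨ha, hb⟩)
    · intro ha
      exact ⟨fun _ h _ => ha h, fun h => absurd rfl h, fun _ h _ => ha h⟩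
  have hD2 : petalDown ![A ∩ N, B ∩ N, A ∩ B] 2 = Nᶜ := by
    ext ω
    simp only [petalDown, Set.mem_setOf_eq, forallT_fin_three, e0, e1, e2, Set.mem_inter_iff, Set.mem_compl_iff, not_and]
    constructor
    · rintro ⟨h1, h2, -⟩ hn
      rcases hNs hn with ha | hb
      · exact h1 (by decide) ha hn
      · exact h2 (by decide) hb hn
    · intro hn
      exact ⟨fun _ _ h => hn h, fun _ _ h => hn h, fun h => absurd rfl h⟩
  -- the masses in cells
  obtain ⟨hAm, hABm⟩ := cells_of_sandwich p hAB hNs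
  have hNs' : N ⊆ B ∪ A := fun ω hω => (hNs hω).symm
  obtain ⟨hBm, -⟩ := cells_of_sandwich p hBA hNs'
  rw [Set.inter_comm B A] at hBm
  have hsum := cells_sum_eq_one p A B N
  have hAN : m⟦p, A ∩ N⟧ = m⟦p, A \ B⟧ + m⟦p, A ∩ B ∩ N⟧ := by
    have h1 := massT_split p A N
    have h2 : A \ N = (A ∩ B) \ N := by
      ext ω; simp only [Set.mem_sdiff, Set.mem_inter_iff]
      refine ⟨fun ⟨ha, hn⟩ => ⟨⟨ha, ?_⟩, hn⟩, fun ⟨⟨ha, _⟩, hn⟩ => ⟨ha, hn⟩⟩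
      by_contra hb; exact hn (hAB ⟨ha, hb⟩)
    rw [h2] at h1
    linarith
  have hBN : m⟦p, B ∩ N⟧ = m⟦p, B \ A⟧ + m⟦p, A ∩ B ∩ N⟧ := by
    have h1 := massT_split p B N
    have h2 : B \ N = (A ∩ B) \ N := by
      ext ω; simp only [Set.mem_sdiff, Set.mem_inter_iff]
      refine ⟨fun ⟨hb, hn⟩ => ⟨⟨?_, hb⟩, hn⟩, fun ⟨⟨_, hb⟩, hn⟩ => ⟨hb, hn⟩⟩
      by_contra ha; exact hn (hBA ⟨hb, ha⟩)
    rw [h2] at h1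
    linarith
  have hNm : m⟦p, N⟧ = m⟦p, A \ B⟧ + m⟦p, B \ A⟧ + m⟦p, A ∩ B ∩ N⟧ := by
    have h1 := massT_split p N A
    have h2 : N ∩ A = A ∩ N := Set.inter_comm N A
    have h3 : N \ A = B \ A := by
      ext ω; simp only [Set.mem_sdiff]
      exact ⟨fun ⟨hn, ha⟩ => ⟨(hNs hn).resolve_left ha, ha⟩, fun ⟨hb, ha⟩ => ⟨hBA ⟨hb, ha⟩, ha⟩⟩
    rw [h2, h3, hAN] at h1
    linarith
  have hG := gladkovDefect_nonneg p hA hB hN hAB hBA hNs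
  obtain ⟨hc, ho⟩ := h _ _ hup hsf
  rw [hO] at hc ho
  rw [strongCubicMax_nonneg_iff p hG]
  -- abbreviations for the cells
  have hGdef : gladkovDefect p A B N = m⟦p, A ∩ B ∩ N⟧ * m⟦p, (A ∪ B)ᶜ⟧
      - (m⟦p, A \ B⟧ * m⟦p, B \ A⟧ + m⟦p, A \ B⟧ * m⟦p, (A ∩ B) \ N⟧ + m⟦p, B \ A⟧ * m⟦p, (A ∩ B) \ N⟧) := rfl
  set α := m⟦p, A \ B⟧ with hα
  set β := m⟦p, B \ A⟧ with hβ
  set κ := m⟦p, A ∩ B ∩ N⟧ with hκ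
  set d := m⟦p, (A ∩ B) \ N⟧ with hd
  set o := m⟦p, (A ∪ B)ᶜ⟧ with hoo
  rcases le_total o κ with hle | hle
  · left
    have h' := hc hle
    rw [Fin.prod_univ_three, e0, e1, e2, hAN, hBN, hABm, show (3 - 1 : ℕ) = 2 from rfl] at h'
    -- h' : (α + κ) * (β + κ) * (κ + d) ≤ κ ^ 2
    have ho1 : o = 1 - (α + β + κ + d) := by linarith
    have key : κ * gladkovDefect p A B N - α * β * d = κ ^ 2 - (α + κ) * (β + κ) * (κ + d) := by
      rw [hGdef, ho1]; ring
    linarith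
  · right
    have h' := ho hle
    rw [Fin.prod_univ_three, hD0, hD1, hD2, massT_compl p B, massT_compl p A, massT_compl p N, hAm, hBm, hNm,
      show (3 - 1 : ℕ) = 2 from rfl] at h'
    have ho1 : o = 1 - (α + β + κ + d) := by linarith
    have key : o * gladkovDefect p A B N - α * β * d
        = o ^ 2 - (1 - (β + κ + d)) * (1 - (α + κ + d)) * (1 - (α + β + κ)) := by
      rw [hGdef, ho1]; ring
    linarith

/-! ### 2'. `S₃^max ⟹ SunflowerOnePayer 3` -/

omit [Fintype ι] in
/-- Every event of a finite cube is determined by all coordinates. [folklore] -/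
private theorem determinedByT_univ [Fintype ι] (E : Set (Set ι)) : DeterminedBy E (↑(Finset.univ : Finset ι) : Set ι) := by
  rw [Finset.coe_univ]
  exact dependsOn_univ _

/-- **S₃^max ⟹ `SunflowerOnePayer 3`**: a 3-sunflower `(U_0, U_1, U_2)` with kernel `K` is the sunflower of the sandwiched
triple `A = U_0 ∪ U_2`, `B = U_1 ∪ U_2`, `N = U_0 ∪ U_1` (`A∩B = U_2`, `A∩B∩N = K`, `(A∪B)ᶜ = O`, `Aᶜ, Bᶜ, Nᶜ = D_1, D_0, D_2`,
petals `U_i ∖ K`), and "the heavier side pays" is `(o − κ)·G`. [this work] -/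
theorem sunflowerOnePayer_three_of_strongCubicMaxNonneg (p : ι → unitInterval) (h : StrongCubicMaxNonneg p) :
    SunflowerOnePayer 3 p := by
  intro U K hU hK
  have h01 : U 0 ∩ U 1 = K := hK 0 1 (by decide)
  have h02 : U 0 ∩ U 2 = K := hK 0 2 (by decide)
  have h12 : U 1 ∩ U 2 = K := hK 1 2 (by decide)
  have hK0 : K ⊆ U 0 := by rw [← h01]; exact Set.inter_subset_left
  have hK1 : K ⊆ U 1 := by rw [← h01]; exact Set.inter_subset_right
  have hK2 : K ⊆ U 2 := by rw [← h02]; exact Set.inter_subset_right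
  have m01 : ∀ {ω}, ω ∈ U 0 → ω ∈ U 1 → ω ∈ K := fun h0 h1 => by rw [← h01]; exact ⟨h0, h1⟩
  have m02 : ∀ {ω}, ω ∈ U 0 → ω ∈ U 2 → ω ∈ K := fun h0 h2 => by rw [← h02]; exact ⟨h0, h2⟩
  have m12 : ∀ {ω}, ω ∈ U 1 → ω ∈ U 2 → ω ∈ K := fun h1 h2 => by rw [← h12]; exact ⟨h1, h2⟩
  -- the sandwiched triple (kept as explicit unions)
  have hA : IsUpperSet (U 0 ∪ U 2) := (hU 0).union (hU 2)
  have hB : IsUpperSet (U 1 ∪ U 2) := (hU 1).union (hU 2)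
  have hN : IsUpperSet (U 0 ∪ U 1) := (hU 0).union (hU 1)
  have hAB : (U 0 ∪ U 2) \ (U 1 ∪ U 2) ⊆ U 0 ∪ U 1 := fun ω ⟨h, h'⟩ =>
    h.elim Or.inl fun h2 => absurd (Or.inr h2) h'
  have hBA : (U 1 ∪ U 2) \ (U 0 ∪ U 2) ⊆ U 0 ∪ U 1 := fun ω ⟨h, h'⟩ =>
    h.elim Or.inr fun h2 => absurd (Or.inr h2) h'
  have hNs : U 0 ∪ U 1 ⊆ (U 0 ∪ U 2) ∪ (U 1 ∪ U 2) := fun ω h =>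
    h.elim (fun h0 => Or.inl (Or.inl h0)) fun h1 => Or.inr (Or.inl h1)
  -- identification of the cells
  have eAB : (U 0 ∪ U 2) ∩ (U 1 ∪ U 2) = U 2 := by
    ext ω; simp only [Set.mem_inter_iff, Set.mem_union]
    constructor
    · rintro ⟨h | h, h' | h'⟩
      · exact hK2 (m01 h h')
      · exact h'
      · exact h
      · exact h
    · exact fun h => ⟨Or.inr h, Or.inr h⟩
  have eK : (U 0 ∪ U 2) ∩ (U 1 ∪ U 2) ∩ (U 0 ∪ U 1) = K := by
    rw [eAB]
    ext ω; simp only [Set.mem_inter_iff, Set.mem_union]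
    constructor
    · rintro ⟨h2, h0 | h1⟩
      · exact m02 h0 h2
      · exact m12 h1 h2
    · exact fun h => ⟨hK2 h, Or.inl (hK0 h)⟩
  have eP0 : (U 0 ∪ U 2) \ (U 1 ∪ U 2) = U 0 \ K := by
    ext ω; simp only [Set.mem_sdiff, Set.mem_union, not_or]
    constructor
    · rintro ⟨h0 | h2, h1, h2'⟩
      · exact ⟨h0, fun hk => h1 (hK1 hk)⟩
      · exact absurd h2 h2'
    · rintro ⟨h0, hk⟩
      exact ⟨Or.inl h0, fun h1 => hk (m01 h0 h1), fun h2 => hk (m02 h0 h2)⟩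
  have eP1 : (U 1 ∪ U 2) \ (U 0 ∪ U 2) = U 1 \ K := by
    ext ω; simp only [Set.mem_sdiff, Set.mem_union, not_or]
    constructor
    · rintro ⟨h1 | h2, h0, h2'⟩
      · exact ⟨h1, fun hk => h0 (hK0 hk)⟩
      · exact absurd h2 h2'
    · rintro ⟨h1, hk⟩
      exact ⟨Or.inl h1, fun h0 => hk (m01 h0 h1), fun h2 => hk (m12 h1 h2)⟩
  have eP2 : ((U 0 ∪ U 2) ∩ (U 1 ∪ U 2)) \ (U 0 ∪ U 1) = U 2 \ K := by
    rw [eAB]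
    ext ω; simp only [Set.mem_sdiff, Set.mem_union, not_or]
    constructor
    · rintro ⟨h2, h0, -⟩
      exact ⟨h2, fun hk => h0 (hK0 hk)⟩
    · rintro ⟨h2, hk⟩
      exact ⟨h2, fun h0 => hk (m02 h0 h2), fun h1 => hk (m12 h1 h2)⟩
  have eO : ((U 0 ∪ U 2) ∪ (U 1 ∪ U 2))ᶜ = outside U := by
    ext ω
    simp only [outside, Set.mem_compl_iff, Set.mem_union, Set.mem_setOf_eq, forallT_fin_three, not_or]
    tauto
  have eD0 : petalDown U 0 = (U 1 ∪ U 2)ᶜ := by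
    ext ω
    simp only [petalDown, Set.mem_compl_iff, Set.mem_union, Set.mem_setOf_eq, forallT_fin_three, not_or]
    exact ⟨fun ⟨_, h1, h2⟩ => ⟨h1 (by decide), h2 (by decide)⟩, fun ⟨h1, h2⟩ => ⟨fun h => absurd rfl h, fun _ => h1, fun _ => h2⟩⟩
  have eD1 : petalDown U 1 = (U 0 ∪ U 2)ᶜ := by
    ext ω
    simp only [petalDown, Set.mem_compl_iff, Set.mem_union, Set.mem_setOf_eq, forallT_fin_three, not_or]
    exact ⟨fun ⟨h0, _, h2⟩ => ⟨h0 (by decide), h2 (by decide)⟩, fun ⟨h0, h2⟩ => ⟨fun _ => h0, fun h => absurd rfl h, fun _ => h2⟩⟩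
  have eD2 : petalDown U 2 = (U 0 ∪ U 1)ᶜ := by
    ext ω
    simp only [petalDown, Set.mem_compl_iff, Set.mem_union, Set.mem_setOf_eq, forallT_fin_three, not_or]
    exact ⟨fun ⟨h0, h1, _⟩ => ⟨h0 (by decide), h1 (by decide)⟩, fun ⟨h0, h1⟩ => ⟨fun _ => h0, fun _ => h1, fun h => absurd rfl h⟩⟩
  -- masses: members = kernel + petal, down-sets by complement
  have hu0 : m⟦p, U 0⟧ = m⟦p, K⟧ + m⟦p, U 0 \ K⟧ := by
    have := massT_split p (U 0) K; rwa [Set.inter_eq_right.2 hK0] at this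
  have hu1 : m⟦p, U 1⟧ = m⟦p, K⟧ + m⟦p, U 1 \ K⟧ := by
    have := massT_split p (U 1) K; rwa [Set.inter_eq_right.2 hK1] at this
  have hu2 : m⟦p, U 2⟧ = m⟦p, K⟧ + m⟦p, U 2 \ K⟧ := by
    have := massT_split p (U 2) K; rwa [Set.inter_eq_right.2 hK2] at this
  obtain ⟨hAm, -⟩ := cells_of_sandwich p hAB hNs
  have hNs' : U 0 ∪ U 1 ⊆ (U 1 ∪ U 2) ∪ (U 0 ∪ U 2) := fun ω hω => (hNs hω).symm
  obtain ⟨hBm, -⟩ := cells_of_sandwich p hBA hNs'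
  rw [Set.inter_comm (U 1 ∪ U 2) (U 0 ∪ U 2)] at hBm
  have hsum := cells_sum_eq_one p (U 0 ∪ U 2) (U 1 ∪ U 2) (U 0 ∪ U 1)
  simp only [eP0, eP1, eP2, eK, eO] at hsum hAm hBm
  have hNm : m⟦p, U 0 ∪ U 1⟧ = m⟦p, U 0 \ K⟧ + m⟦p, U 1 \ K⟧ + m⟦p, K⟧ := by
    have h1 := massT_split p (U 0 ∪ U 1) (U 0)
    have h2 : (U 0 ∪ U 1) ∩ U 0 = U 0 := Set.inter_eq_right.2 Set.subset_union_left
    have h3 : (U 0 ∪ U 1) \ U 0 = U 1 \ K := by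
      ext ω; simp only [Set.mem_sdiff, Set.mem_union]
      constructor
      · rintro ⟨h0 | h1, h0'⟩
        · exact absurd h0 h0'
        · exact ⟨h1, fun hk => h0' (hK0 hk)⟩
      · rintro ⟨h1, hk⟩; exact ⟨Or.inr h1, fun h0 => hk (m01 h0 h1)⟩
    rw [h2, h3, hu0] at h1
    linarith
  -- S₃^max for the sandwiched triple
  have hG := gladkovDefect_nonneg p hA hB hN hAB hBA hNs
  have hsc := h Finset.univ _ _ _ hA hB hN hAB hBA hNs (determinedByT_univ _) (determinedByT_univ _) (determinedByT_univ _)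
  rw [strongCubicMax_nonneg_iff p hG] at hsc
  have hGdef : gladkovDefect p (U 0 ∪ U 2) (U 1 ∪ U 2) (U 0 ∪ U 1)
      = m⟦p, K⟧ * m⟦p, outside U⟧
        - (m⟦p, U 0 \ K⟧ * m⟦p, U 1 \ K⟧ + m⟦p, U 0 \ K⟧ * m⟦p, U 2 \ K⟧ + m⟦p, U 1 \ K⟧ * m⟦p, U 2 \ K⟧) := by
    simp only [gladkovDefect]; rw [eP0, eP1, eP2, eK, eO]
  rw [eP0, eP1, eP2, eK, eO, hGdef] at hsc
  set c0 := m⟦p, U 0 \ K⟧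
  set c1 := m⟦p, U 1 \ K⟧
  set c2 := m⟦p, U 2 \ K⟧
  set κ := m⟦p, K⟧
  set o := m⟦p, outside U⟧
  have ho1 : o = 1 - (c0 + c1 + κ + c2) := by linarith
  have hGnn : 0 ≤ κ * o - (c0 * c1 + c0 * c2 + c1 * c2) := by rw [← hGdef]; exact hG
  refine ⟨fun hle => ?_, fun hle => ?_⟩
  · -- kernel at least as heavy ⟹ kernel pays
    rw [Fin.prod_univ_three, hu0, hu1, hu2, show (3 - 1 : ℕ) = 2 from rfl]
    have hX : c0 * c1 * c2 ≤ κ * (κ * o - (c0 * c1 + c0 * c2 + c1 * c2)) := by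
      rcases hsc with hc | ho'
      · exact hc
      · exact le_trans ho' (mul_le_mul_of_nonneg_right hle hGnn)
    have key : κ ^ 2 - (κ + c0) * (κ + c1) * (κ + c2) = κ * (κ * o - (c0 * c1 + c0 * c2 + c1 * c2)) - c0 * c1 * c2 := by
      rw [ho1]; ring
    linarith
  · -- outside at least as heavy ⟹ outside pays
    rw [Fin.prod_univ_three, eD0, eD1, eD2, massT_compl, massT_compl, massT_compl, hAm, hBm, hNm,
      show (3 - 1 : ℕ) = 2 from rfl]
    have hY : c0 * c1 * c2 ≤ o * (κ * o - (c0 * c1 + c0 * c2 + c1 * c2)) := by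
      rcases hsc with hc | ho'
      · exact le_trans hc (mul_le_mul_of_nonneg_right hle hGnn)
      · exact ho'
    have key : o ^ 2 - (1 - (c1 + κ + c2)) * (1 - (c0 + κ + c2)) * (1 - (c0 + c1 + κ))
        = o * (κ * o - (c0 * c1 + c0 * c2 + c1 * c2)) - c0 * c1 * c2 := by
      rw [ho1]; ring
    linarith

/-- **`k = 3` of the conjecture is exactly S₃^max.** [this work] -/
theorem sunflowerOnePayer_three_iff (p : ι → unitInterval) : SunflowerOnePayer 3 p ↔ StrongCubicMaxNonneg p :=
  ⟨strongCubicMaxNonneg_of_sunflowerOnePayer_three p, sunflowerOnePayer_three_of_strongCubicMaxNonneg p⟩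

/-- Consequently every level `k ≥ 3` of the conjecture implies S₃^max (hence S₃⁺, S₃ and the co-sunflower class law, by the
links of `…SahiStrongCubicMax`). [this work] -/
theorem strongCubicMaxNonneg_of_sunflowerOnePayer (p : ι → unitInterval) {k : ℕ} (hk : 3 ≤ k) (h : SunflowerOnePayer k p) :
    StrongCubicMaxNonneg p :=
  strongCubicMaxNonneg_of_sunflowerOnePayer_three p (sunflowerOnePayer_of_le p (by norm_num) hk h)

end SahiDeepCore

end Summit.CriticalPhenomena.PercolationContinuityZ3.Theorems

end
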